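import Literature.MathematicalPhysics.QuantumFieldTheory.Balaban1983to89.HiggsGaugeInvariance
import Literature.MathematicalPhysics.QuantumFieldTheory.Balaban1983to89.B2Eq255Concrete
import Literature.MathematicalPhysics.QuantumFieldTheory.Balaban1983to89.B2Ineq329PrismHolonomy

/-!
# `Balaban1983to89.B2Eq273GaugeCovariance` — [Balaban1982Higgs2] Lemma 2.4, proof steps **(2.69)–(2.74)** pp. 572–573
# («Now the constant field A₀ can be "gauged out" … how the operator −Δ^{η,N}_{A₀,□} + m²(Lᵏε)² + a_kP_k(A₀)□ transforms
# itself under this gauge transformation»; (2.72) `Q_k(A₀)φ₀ = U(A₀(Γ_{y′,y}))Q_kφ₀′`; (2.73) `G_k(□,A₀;x,x′) =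
# U(A₀(Γ_{x,y}))G_k(□,0;x,x′)U(A₀(Γ_{y,x′}))`; (2.74)) ON THE (Higgs)₂,₃ CARRIER OF RECORD, IN GENERAL FORM: the operators of
# [Balaban1982Higgs1] (2.11)/(2.20) and the background field (2.56) — the typer's `avgQk`, `avgQkAdj`, `projPk`,
# `covLaplacianN Ω`, `covOpK`, `propagatorK`, its `kernel`, `B2Eq255Concrete.bgScalar256` — are COVARIANT under EVERY abelian
# gauge transformation `(A, f, ψ) ↦ (A − ∂λ, U(λ)f, U(λ_k)ψ)`, for every region, field, level; the constant field's gauge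
# function `εA₀(Γ_{o,·})` is the printed special case

statement-level skeleton of published theorems with citation tags; proofs where landed; nothing here is a claim
about the Yang–Mills mass gap

PDF held: `paper:balaban1982-cmp86-higgs23-ii` (journal page = PDF page + 554); pp. 572–573 [PDF 18–19] re-read on the text
layer (`lit read … --pages 18-20`, this session) — the displays (2.69)–(2.74) and the sentences quoted below are on p0018
L19–33 and p0019 L2–17; [Balaban1982Higgs1] `paper:balaban1982-cmp85-higgs23-i` p. 605 (1.7), p. 608 (2.1)–(2.3),
p. 610 (2.20).

CITATION HEADER (lean-in-tree rule).  T. Bałaban, *(Higgs)₂,₃ quantum fields in a finite volume. II. An upper bound*,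
Commun. Math. Phys. **86** (1982) 555–594, doi:10.1007/bf01214890 [Balaban1982Higgs2]; the operators are those of
T. Bałaban, *(Higgs)₂,₃ quantum fields in a finite volume. I. A lower bound*, Commun. Math. Phys. **85** (1982) 603–626
[Balaban1982Higgs1] ((1.7) `U(A) = exp(qεeA)`, (2.1)–(2.3) the contours `Γ_{y,x}`, `Γ^{(k)}_{y,x}`, (2.11) `Q_k(A)`, (2.17)/(2.20)
`−Δ^{ε,N}_{A,Ω}`, `P_k(A) = Q_k^*(A)Q_k(A)`, `G^ε_k(Ω,A)`), AS TYPED by the typer (`HiggsLattice`, `HiggsAveraging`,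
`HiggsCovariance`, `HiggsCovariancePos`) and by p28 (`HiggsGaugeInvariance`: the gauge transformation `gaugeVec λ A = A − ∂λ`,
`rot λ φ = U(λ)φ`, the covariance `covDeriv_gauge` of (1.7)).  Cell `lit-balaban` (HOME `run/shared/lean/pub/lit-balaban/`),
Phase-2 proof seat **p23** gen 21 (unit `lit-balaban-p23-g21`; free-target protocol G.5-34(d), TAKING line HOME/STATUS.md
2026-08-23T01:39Z); SKELETON row **B2.Lem2.4** (Lemma 2.4 (2.65)–(2.66) p. 572; fold owner r02, second reader r14; decl of
record `B2.Lemma24Printed`, head `proved p250408 · …` UNCHANGED — this file is a cells-only member: the printed steps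
(2.69)–(2.74) for the carrier of record's own objects; brick F1 of the seat's programme «(2.68)/(2.65) on the (Higgs)₂,₃ carrier
of record», HOME/HANDOFF § p23 gen 19/20 item (iii)).  Cross-references: rows **B1.Eq1.7** (gauge covariance of `D^η_A`, p28
p309772), **B1.Eq2.20** (the operators), **B2.Eq2.55** ((2.56) `bgScalar256`, typer p250795).  USED BY NAME, never restated:
the typer's `HiggsAveraging.{shiftN, segSum, corner, contourSum, multiContourSum, toFinest, blockIter, blockK, avgQk}`,
`HiggsCovariance.{fwdTerm, bwdTerm, covLaplacianN, avgQkLin, avgQkAdj, projPk, covOpK, propagatorK, kernel}`,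
`HiggsCovariancePos.shift_unshift`, p28's `HiggsGaugeInvariance.{gaugeVec, rot, rot_rot_neg, rot_neg_rot, covDeriv_gauge, norm_U}`,
`HiggsHodgeIdentity.grad`, the typer's `B2Eq255Concrete.{bgScalar256, bgScalar256_eq, cutTo, cutTo_of_mem, cutTo_of_not_mem}`,
p17's `B2Restr216Lattice.{shiftN_succ, shiftN_zero, toFinest_zero, cornerN, cornerN_zero, cornerN_d}`, own gen 9's
`B2Ineq329PrismHolonomy.{corner_eq_cornerN, shiftN_cornerN_succ}`.
The b04 lineage's version of the same printed steps on ITS box carrier is own gen 5 `B2Eq268GaugeAway` §2 (`gaugeU`,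
`avgA_constBond`, `greenA0_eq_gauge`, `main_gauge`); nothing of it is used or restated here (different carrier).

WHAT IS PRINTED (pp. 572–573 [PDF 18–19], verbatim from the text layer).  *«Now the constant field A₀ can be "gauged out"
from the last expression above. We use a gauge transformation defined on □ by the formula φ₀(x) = U(A₀(Γ_{x,y}))φ₀′(x),
x ∈ □, where the contour Γ_{x,y} = −Γ_{y,x} is defined as in (I.2.1.), but now for the points x from □ instead of the block
B(y). Let us consider how the operator −Δ^{η,N}_{A₀,□} + m²(Lᵏε)² + a_kP_k(A₀)□ transforms itself under this gauge
transformation. We consider the terms determining the corresponding quadratic form: … (2.69) but the contour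
Γ_{y,b₋}∪b∪Γ_{b₊,y} is closed and bounds some surface ⊂ □, so using Stokes' theorem we have … (2.70) hence
(D^η_{A₀}φ₀)(b) = U(A₀(Γ_{b₋,y}))(∂^ηφ₀′)(b), and … Furthermore for y′ ∈ □₂, (Q_k(A₀)φ₀)(y′) = … = U(A₀(Γ_{y′,y})) Σ_{x′∈Bᵏ(y′)}
η^dU(A₀(Γ_{y′,y}∪Γ^{(k)}_{y′,x′}∪Γ_{x′,y}))φ₀′(x′), (2.71) and because A₀(Γ_{y′,y}∪Γ^{(k)}_{y′,x′}∪Γ_{x′,y}) = 0 again, so we have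
(Q_k(A₀)φ₀)(y′) = U(A₀(Γ_{y′,y}))(Q_kφ₀′)(y′) and |(Q_k(A₀)φ₀)(y′)|² = |(Q_kφ₀′)(y′)|². (2.72) Hence the operator
−Δ^{η,N}_{A₀,□} + m²(Lᵏε)² + a_kP_k(A₀)□ is transformed into the operator −Δ^{η,N}_{0,□} + m²(Lᵏε)² + a_kP_k□, and we have
G_k(□, A₀; x, x′) = U(A₀(Γ_{x,y}))G_k(□, 0; x, x′)U(A₀(Γ_{y,x′})). (2.73) Together with the gauge transformation of the
propagators we make the corresponding transformation of the field φ, i.e. φ(y′) = U(A₀(Γ_{y′,y}))φ′(y′). Then the last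
expression in (2.68) transforms itself as follows (a_kG_k(□, A₀)Q_k^*(A₀)□₁φ)(x) = U(A₀(Γ_{x,y}))(a_kG_k(□, 0)Q_k^*□₁φ′)(x).
(2.74)»*

THE ARGUMENT, GENERALISED (ours; print's is the special case `A = A₀` constant, `λ = εA₀(Γ_{y,·})`, `A − ∂λ = 0` on `□`).
For ANY gauge function `λ : T_ε → ℝ` write `U(λ)` for the site-wise rotation `f(x) ↦ U_ε(ε⁻¹λ(x))f(x) = exp(qeλ(x))f(x)` (p28's
`rot`) and `λ_k(y) := λ(ȳ)`, `ȳ = toFinest y ∈ T_ε` the site labelling the block point `y ∈ T^{(k)}` (the START of the typer's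
composite contour `Γ^{(k)}_{y,x}`).  The representation `U` is of the ABELIAN group `(ℝ,+)`, so every transporter factorises:
a pure gauge sums along a contour to the difference of its endpoint values — `(∂λ)(Γ_{y,x}) = ε⁻¹(λ(x) − λ(y))` for the
staircase (I.2.1) (its `μ`-th segment runs from the corner `t = μ+1` to the corner `t = μ`; telescoping) and
`(∂λ)(Γ^{(k)}_{y,x}) = ε⁻¹(λ(x) − λ(ȳ))` for the composite contour (I.2.2) — whence `U((A − ∂λ)(Γ^{(k)}_{y,x})) =
U(λ(ȳ))U(A(Γ^{(k)}_{y,x}))U(λ(x))⁻¹` (print's (2.71): «A₀(closed contour) = 0»).  Consequently `Q_k(A − ∂λ)U(λ) = U(λ_k)Q_k(A)`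
((2.72)), `Q_k^*(A − ∂λ)U(λ_k) = U(λ)Q_k^*(A)`, `P_k(A − ∂λ)U(λ) = U(λ)P_k(A)`; bond by bond `U((A−∂λ)_b)U(λ(b₊)) = U(λ(b₋))U(A_b)`
((2.69)–(2.70)), so `−Δ^{ε,N}_{A−∂λ,Ω}U(λ) = U(λ)(−Δ^{ε,N}_{A,Ω})` for EVERY region `Ω` (the Neumann cut does not see the gauge);
hence `H_k(Ω, A − ∂λ) = U(λ)H_k(Ω,A)U(λ)⁻¹` for `H_k = −Δ^{ε,N}_{A,Ω} + m² + a_k(Lᵏε)⁻²P_k(A)` (print's «is transformed into the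
operator …») and — since `Ring.inverse` commutes with conjugation by a unit, with NO invertibility hypothesis —
`G^ε_k(Ω, A − ∂λ) = U(λ)G^ε_k(Ω,A)U(λ)⁻¹`, i.e. `G^ε_k(Ω, A−∂λ; x, x′) = U(λ(x))G^ε_k(Ω, A; x, x′)U(λ(x′))⁻¹` ((2.73)), and for the
background field (2.56) `φ^{(k)}[A − ∂λ, U(λ_k)φ] = U(λ)φ^{(k)}[A, φ]` ((2.74)), with its covariant derivative rotating the same
way ((2.77)'s structure).  For print's constant `A₀` (values `c_μ`): the gauge function `λ_o(z) := ε·Σ_μ c_μ n_μ(z)`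
(`n_μ(z) ∈ [0, |T_ε|_μ)` the forward steps from a corner `o`) EQUALS `ε·A₀(Γ_{o,z})` for the carrier's staircase and has
`(∂λ_o)_b = (A₀)_b` on every bond that does not wrap around the period box based at `o`; so `(A₀ + A′) − ∂λ_o = A′ + (A₀ − ∂λ_o)`
with the SEAM FIELD `A₀ − ∂λ_o` vanishing off the seam, and (2.73)/(2.74) hold in print's letters with `U(A₀(Γ_{x,o}))`,
`U(A₀(Γ_{o,x′}))` and `G_k(Ω, A′ + seam)` in place of `G_k(□, 0)`.

WHAT THIS FILE PROVES (kernel-checked, zero `sorry`; axioms standard; NO `Prop`-valued fact; plumbing definitions with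
bodies: `rotL`/`rotUnit` (p28's `rot` as a linear map / a unit), `constVec`, `cornerGauge`, `seamField`).
 §1 `U_add_apply`, `U_angle_eq` (the rotation by an angle does not depend on the spacing used to write it),
    `U_angle_add`, `star_U_angle`.
 §2 `rotL`, `rotL_apply` (= p28's `rot`), `rotL_mul_rotL_neg`, `rotL_neg_mul_rotL`, `rotUnit`, `rot_single`.
 §3 `segSum_grad` (**`(∂λ)(segment) = ε⁻¹(λ(end) − λ(start))`**), **`contourSum_grad`** (`(∂λ)(Γ_{y,x}) = ε⁻¹(λ(x) − λ(y))`), **`multiContourSum_grad`**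
    (`(∂λ)(Γ^{(k)}_{y,x}) = ε⁻¹(λ(x) − λ(ȳ))`), `multiContourSum_gaugeVec`, **`U_multiContourSum_gaugeVec`** /
    `star_U_multiContourSum_gaugeVec` (the transporters of a gauged field — (2.71)).
 §4 `rot_add_field`, `rot_smul_field`, `rot_zero_field`, `norm_rot_apply`, `U_gauge_fwd`, `U_gauge_bwd` ((2.69)–(2.70) bond by bond).
 §5 **`covLaplacianN_gauge`** (every `Ω`, level `k`), **`avgQk_gauge`** / `avgQkLin_gauge` ((2.72)), **`avgQkAdj_gauge`**,
    **`projPk_gauge`**, **`covOpK_gauge`** / `covOpK_gauge_conj` («the operator … is transformed into the operator …»).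
 §6 private `ring_inverse_conj` ([folklore]: `Ring.inverse(uHu⁻¹) = u·Ring.inverse(H)·u⁻¹`, unconditionally), **`propagatorK_gauge_conj`** /
    `propagatorK_gauge` (**(2.73) at operator level**), **`kernel_propagatorK_gauge`** ((2.73) for the kernels),
    `cutTo_rot`, **`bgScalar256_gauge`** (**(2.74)** for the typer's (2.56)), `covDeriv_bgScalar256_gauge` ((2.77)'s structure),
    `norm_bgScalar256_gauge` (sup norms of `φ^{(k)}` and `D^ε_Aφ^{(k)}` are gauge invariant).
 §7 `constVec`, `cornerGauge`, `segSum_constVec`, **`contourSum_constVec`** (`A₀(Γ_{o,z}) = Σ_μ n_μ(z)c_μ`),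
    `cornerGauge_eq_contourSum`, `U_cornerGauge` (the rotation by `λ_o` IS print's `U(A₀(Γ_{o,·}))`), `one_lt_sitesPerDir`,
    **`grad_cornerGauge_of_noWrap`** (`∂λ_o = A₀` off the seam), `seamField`, `seamField_eq_zero_of_noWrap`,
    `gaugeVec_cornerGauge`, `gaugeVec_neg_gaugeVec`, **`kernel_propagatorK_constVec`** ((2.73) in print's letters, exact on the
    torus, `G_k(Ω, A′ + seam)` for `G_k(□, 0)`), **`bgScalar256_constVec`** ((2.74) in print's letters).

HONEST SCOPE / DIFFERENCES FROM PRINT (recorded, not hidden).  (a) Everything is an EXACT identity on the whole torus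
`T_ε` of the carrier, for arbitrary `Ω`, `A`, `λ`, `m²`, `a`, `k`; no estimate, no smallness, no invertibility hypothesis.
(b) Print gauges away a CONSTANT field on the BOX `□ = Bᵏ(□₂)` and reads `G_k(□, 0)`; here the general gauge covariance is
proved and the constant field's gauge `λ_o` is supplied with `∂λ_o = A₀` OFF THE SEAM of the period box based at the corner
`o` — on the torus a constant field is NOT a pure gauge (holonomy), so the exact statement carries the seam field
`A₀ − ∂λ_o` (zero on every non-wrapping bond): §7's (2.73)/(2.74) read `G^ε_k(Ω, A′ + seam)` where print has `G_k(□, 0)`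
(`A′ = 0`).  That `G^ε_k(□, ·)f` at the sites of a box `□` not meeting the seam, for `f` supported in `□`, does not depend on
the field off `□` (so that the seam field is invisible and print's literal (2.73) on `□ × □` follows) is the LOCALITY of the
Neumann box operator — NOT proved here (successor brick F2 of the seat's programme).  (c) Print's gauge is based at the
block point `y` with two-sided contours `Γ_{x,y} = −Γ_{y,x}` «for the points x from □»; the carrier's staircase only steps
forward (mod the period), so the corner `o` of this file is to be taken at (or below) the lower corner of `□`, not at its
centre `y` — the two gauge functions then differ by the constant `εA₀(Γ_{o,y})` on `□`, immaterial for (2.73)/(2.74).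
(d) `λ_k(y) = λ(toFinest y)`: the carrier anchors `Γ^{(k)}_{y,x}` at the site `toFinest y` (the block's base corner), print
at «y» — the same point under the typer's identification (1.20).  (e) Nothing about (2.68), (2.75)–(2.77)'s estimates or
(2.65)–(2.66) on this carrier (bricks F3–F5).  Value = kernel certificate of the printed gauge step on the carrier of
record, reusable by every later gauge argument on this carrier ([B1] p. 605, [B2] Lemma 2.3/2.4/(3.29), [B4] §2/§5); NOT
summit progress.
-/

open scoped BigOperators

noncomputable section

namespace Literature.MathematicalPhysics.QuantumFieldTheory.Balaban1983to89.B2Eq273GaugeCovariance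

open Literature.MathematicalPhysics.QuantumFieldTheory.Balaban1983to89.HiggsLattice
open Literature.MathematicalPhysics.QuantumFieldTheory.Balaban1983to89.HiggsAveraging
open Literature.MathematicalPhysics.QuantumFieldTheory.Balaban1983to89.HiggsCovariance
open Literature.MathematicalPhysics.QuantumFieldTheory.Balaban1983to89.HiggsCovariancePos
open Literature.MathematicalPhysics.QuantumFieldTheory.Balaban1983to89.HiggsHodgeIdentity (grad)
open Literature.MathematicalPhysics.QuantumFieldTheory.Balaban1983to89.HiggsGaugeInvariance (gaugeVec rot rot_add
  rot_zero rot_neg_rot rot_rot_neg covDeriv_gauge)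
open Literature.MathematicalPhysics.QuantumFieldTheory.Balaban1983to89.B2Restr216Lattice (shiftN_succ shiftN_zero
  toFinest_zero cornerN cornerN_zero cornerN_d)
open Literature.MathematicalPhysics.QuantumFieldTheory.Balaban1983to89.B2Ineq329PrismHolonomy (corner_eq_cornerN
  shiftN_cornerN_succ)

variable {P : Params} {N : ℕ}

/-! ## §1 The one-parameter group `U` at a gauge angle: algebra used throughout -/

section Group

variable (C : ChargeData N)

/-- applied form of `U_η(a + b) = U_η(a)U_η(b)`. [cite: Balaban1982Higgs1, (1.7) p.605] -/
theorem U_add_apply (η a b : ℝ) (v : E N) : C.U η (a + b) v = C.U η a (C.U η b v) := by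
  rw [ChargeData.U_add]; rfl

/-- `U_η(η⁻¹θ) = exp(qeθ)` does not depend on the spacing `η ≠ 0` used to write it: the gauge rotation by the angle
`θ = λ(x)` is the same operator on every lattice `T^{(k)}` (p28's `rot` at level `k` vs level `0`).
[cite: Balaban1982Higgs1, (1.7) p.605] -/
theorem U_angle_eq {η η' : ℝ} (hη : η ≠ 0) (hη' : η' ≠ 0) (θ : ℝ) : C.U η (η⁻¹ * θ) = C.U η' (η'⁻¹ * θ) := by
  unfold ChargeData.U
  congr 2
  field_simp

/-- `U_η(η⁻¹a)U_η(η⁻¹b) = U_η(η⁻¹(a+b))` (angles add). [cite: Balaban1982Higgs1, (1.7) p.605] -/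
theorem U_angle_add (η a b : ℝ) (v : E N) :
    C.U η (η⁻¹ * a) (C.U η (η⁻¹ * b) v) = C.U η (η⁻¹ * (a + b)) v := by
  rw [← U_add_apply]; congr 2; ring

/-- `star U_η(η⁻¹θ) = U_η(η⁻¹(−θ))`. [cite: Balaban1982Higgs1, (1.7) p.605] -/
theorem star_U_angle (η θ : ℝ) : star (C.U η (η⁻¹ * θ)) = C.U η (η⁻¹ * (-θ)) := by
  rw [ChargeData.star_U]; congr 1; ring

end Group

/-! ## §2 The gauge rotation `U(λ)` as a linear operator on the fields of one lattice; it is a unit -/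

section Rot

variable (C : ChargeData N) {k : ℕ}

/-- p28's gauge rotation `φ ↦ U(λ)φ` (`HiggsGaugeInvariance.rot`) as a LINEAR MAP of the fields on `T^{(k)}`.
[cite: Balaban1982Higgs2, Lemma 2.4 proof p.572 «We use a gauge transformation defined on □ by the formula φ₀(x) = U(A₀(Γ_{x,y}))φ₀′(x)»] -/
def rotL (lam : Site P k → ℝ) : ScalarField P k N →ₗ[ℝ] ScalarField P k N :=
  LinearMap.pi fun x => (C.U (P.mesh k) ((P.mesh k)⁻¹ * lam x)).toLinearMap ∘ₗ
    (LinearMap.proj x : ScalarField P k N →ₗ[ℝ] E N)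

/-- `rotL` IS p28's `rot`. [cite: Balaban1982Higgs1, (1.7) p.605] -/
@[simp] theorem rotL_apply (lam : Site P k → ℝ) (φ : ScalarField P k N) : rotL C lam φ = rot C lam φ := by
  funext x; simp [rotL, rot]

/-- `U(λ)U(−λ) = 1` as operators. [cite: Balaban1982Higgs1, (1.7) p.605] -/
theorem rotL_mul_rotL_neg (lam : Site P k → ℝ) : rotL C lam * rotL C (-lam) = 1 := by
  refine LinearMap.ext fun φ => ?_
  rw [Module.End.mul_apply, rotL_apply, rotL_apply, rot_rot_neg, Module.End.one_apply]

/-- `U(−λ)U(λ) = 1` as operators. [cite: Balaban1982Higgs1, (1.7) p.605] -/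
theorem rotL_neg_mul_rotL (lam : Site P k → ℝ) : rotL C (-lam) * rotL C lam = 1 := by
  refine LinearMap.ext fun φ => ?_
  rw [Module.End.mul_apply, rotL_apply, rotL_apply, rot_neg_rot, Module.End.one_apply]

/-- `U(λ)` is a unit of the endomorphism ring of the fields, with inverse `U(−λ)`. [cite: Balaban1982Higgs1, (1.7) p.605] -/
def rotUnit (lam : Site P k → ℝ) : (Module.End ℝ (ScalarField P k N))ˣ :=
  ⟨rotL C lam, rotL C (-lam), rotL_mul_rotL_neg C lam, rotL_neg_mul_rotL C lam⟩

/-- the unit's value is `U(λ)`. [cite: Balaban1982Higgs1, (1.7) p.605] -/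
@[simp] theorem rotUnit_val (lam : Site P k → ℝ) : ((rotUnit C lam : (Module.End ℝ (ScalarField P k N))ˣ) :
    Module.End ℝ (ScalarField P k N)) = rotL C lam := rfl

/-- the unit's inverse is `U(−λ)`. [cite: Balaban1982Higgs1, (1.7) p.605] -/
@[simp] theorem rotUnit_inv_val (lam : Site P k → ℝ) :
    ((rotUnit C lam)⁻¹ : (Module.End ℝ (ScalarField P k N))ˣ).val = rotL C (-lam) := rfl

/-- the rotation acts on a one-site field by rotating its value: `U(λ)(vδ_{x′}) = (U(λ(x′))v)δ_{x′}`.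
[cite: Balaban1982Higgs1, (1.7) p.605] -/
theorem rot_single (lam : Site P k → ℝ) (x' : Site P k) (v : E N) :
    rot C lam (Pi.single x' v) = Pi.single x' (C.U (P.mesh k) ((P.mesh k)⁻¹ * lam x') v) := by
  funext x
  by_cases hx : x = x'
  · subst hx; simp [rot]
  · simp [rot, hx]

end Rot

/-! ## §3 A pure gauge `∂λ` along the contours of the carrier: telescoping -/

section Contours

variable {lam : Site P 0 → ℝ}

/-- `(∂λ)(⟨u, u + nεe_μ⟩) = ε⁻¹(λ(u + nεe_μ) − λ(u))`: the sum (2.3) of a pure gauge along a straight segment telescopes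
(steps: p17's `B2Restr216Lattice.shiftN_succ/shiftN_zero`). [cite: Balaban1982Higgs1, (2.3) p.608] -/
theorem segSum_grad (lam : Site P 0 → ℝ) (u : Site P 0) (μ : Fin P.d) (n : ℕ) :
    segSum (grad lam) u μ n = (P.mesh 0)⁻¹ * (lam (shiftN u μ n) - lam u) := by
  induction n with
  | zero => simp [segSum, shiftN_zero]
  | succ n ih =>
    rw [segSum, Finset.sum_range_succ, ← segSum, ih]
    simp only [grad, PBond.tgt, shiftN_succ]
    ring


/-- **`(∂λ)(Γ_{y,x}) = ε⁻¹(λ(x) − λ(y))`**: the sum (2.3) of a pure gauge along the staircase contour (2.1) telescopes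
(the `i`-th segment runs from p17's corner `cornerN y x (i+1)` to `cornerN y x i` — own gen 9's
`B2Ineq329PrismHolonomy.corner_eq_cornerN`/`shiftN_cornerN_succ` — and contributes `ε⁻¹(λ(corner_i) − λ(corner_{i+1}))`).
[cite: Balaban1982Higgs1, (2.3) p.608] -/
theorem contourSum_grad (lam : Site P 0 → ℝ) (y x : Site P 0) :
    contourSum (grad lam) y x = (P.mesh 0)⁻¹ * (lam x - lam y) := by
  unfold contourSum
  have hterm : ∀ i : Fin P.d, segSum (grad lam) (corner y x i) i (x i - y i).val
      = (P.mesh 0)⁻¹ * (lam (cornerN y x i) - lam (cornerN y x (i + 1))) := by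
    intro i
    rw [segSum_grad, corner_eq_cornerN, shiftN_cornerN_succ]
  simp_rw [hterm]
  rw [← Finset.mul_sum, Fin.sum_univ_eq_sum_range (fun t => lam (cornerN y x t) - lam (cornerN y x (t + 1))) P.d,
    Finset.sum_range_sub', cornerN_zero, cornerN_d]

/-- **`(∂λ)(Γ^{(k)}_{y,x}) = ε⁻¹(λ(x) − λ(ȳ))`**, `ȳ = toFinest (x_k)` the site of `T_ε` labelling the block point `y = x_k`
(the start of the composite contour (2.2)): the `k` staircase pieces telescope. [cite: Balaban1982Higgs1, (2.2) p.608] -/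
theorem multiContourSum_grad (lam : Site P 0 → ℝ) (k : ℕ) (x : Site P 0) :
    multiContourSum (grad lam) k x = (P.mesh 0)⁻¹ * (lam x - lam (toFinest (blockIter k x))) := by
  unfold multiContourSum
  simp_rw [contourSum_grad]
  rw [← Finset.mul_sum, Finset.sum_range_sub' (fun j => lam (toFinest (blockIter j x))) k]
  simp [blockIter, toFinest_zero]

/-- `(A − ∂λ)(Γ^{(k)}_{y,x}) = A(Γ^{(k)}_{y,x}) − ε⁻¹(λ(x) − λ(ȳ))`. [cite: Balaban1982Higgs1, (2.2) p.608] -/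
theorem multiContourSum_gaugeVec (lam : Site P 0 → ℝ) (A : VecField P 0) (k : ℕ) (x : Site P 0) :
    multiContourSum (gaugeVec lam A) k x
      = multiContourSum A k x + (P.mesh 0)⁻¹ * (lam (toFinest (blockIter k x)) + -lam x) := by
  have h : gaugeVec lam A = A + (-1 : ℝ) • grad lam := by
    funext b; simp [gaugeVec, sub_eq_add_neg]
  rw [h, multiContourSum_add]
  have hs : multiContourSum ((-1 : ℝ) • grad lam) k x = (-1) * multiContourSum (grad lam) k x := by
    simp [multiContourSum, contourSum, segSum, Finset.mul_sum]
  rw [hs, multiContourSum_grad]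
  ring

variable (C : ChargeData N)

/-- **THE TRANSPORT OF A GAUGED FIELD**: `U((A − ∂λ)(Γ^{(k)}_{y,x})) = U(λ(ȳ)) U(A(Γ^{(k)}_{y,x})) U(λ(x))⁻¹` (applied form;
all factors commute).  This is the mechanism of (2.71)–(2.72): for a pure gauge the transport along `Γ^{(k)}_{y,x}`
depends on the endpoints only («because A₀(Γ_{y′,y}∪Γ_{y,x′}∪Γ_{x′,y′}) = 0 again»).
[cite: Balaban1982Higgs2, Lemma 2.4 proof (2.71)–(2.72) p.573] -/
theorem U_multiContourSum_gaugeVec (lam : Site P 0 → ℝ) (A : VecField P 0) (k : ℕ) (x : Site P 0) (v : E N) :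
    C.U (P.mesh 0) (multiContourSum (gaugeVec lam A) k x) v
      = C.U (P.mesh 0) ((P.mesh 0)⁻¹ * lam (toFinest (blockIter k x)))
          (C.U (P.mesh 0) (multiContourSum A k x) (C.U (P.mesh 0) ((P.mesh 0)⁻¹ * (-lam x)) v)) := by
  rw [multiContourSum_gaugeVec, ← U_add_apply, ← U_add_apply]
  congr 2; ring

/-- the adjoint transport of a gauged field: `U((A − ∂λ)(Γ^{(k)}_{y,x}))^* = U(λ(x)) U(A(Γ^{(k)}_{y,x}))^* U(λ(ȳ))⁻¹`.
[cite: Balaban1982Higgs2, Lemma 2.4 proof (2.71)–(2.72) p.573] -/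
theorem star_U_multiContourSum_gaugeVec (lam : Site P 0 → ℝ) (A : VecField P 0) (k : ℕ) (x : Site P 0) (v : E N) :
    star (C.U (P.mesh 0) (multiContourSum (gaugeVec lam A) k x)) v
      = C.U (P.mesh 0) ((P.mesh 0)⁻¹ * lam x)
          (star (C.U (P.mesh 0) (multiContourSum A k x))
            (C.U (P.mesh 0) ((P.mesh 0)⁻¹ * (-lam (toFinest (blockIter k x)))) v)) := by
  rw [ChargeData.star_U, ChargeData.star_U, multiContourSum_gaugeVec, ← U_add_apply, ← U_add_apply]
  congr 2; ring

end Contours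

/-! ## §4 The gauge rotation on fields: pointwise algebra -/

section RotAlgebra

variable (C : ChargeData N) {k : ℕ}

/-- `U(λ)(g + h) = U(λ)g + U(λ)h`. [cite: Balaban1982Higgs1, (1.7) p.605] -/
theorem rot_add_field (lam : Site P k → ℝ) (g h : ScalarField P k N) : rot C lam (g + h) = rot C lam g + rot C lam h := by
  rw [← rotL_apply, map_add, rotL_apply, rotL_apply]

/-- `U(λ)(c·g) = c·U(λ)g`. [cite: Balaban1982Higgs1, (1.7) p.605] -/
theorem rot_smul_field (lam : Site P k → ℝ) (c : ℝ) (g : ScalarField P k N) : rot C lam (c • g) = c • rot C lam g := by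
  rw [← rotL_apply, map_smul, rotL_apply]

/-- `U(λ)0 = 0`. [cite: Balaban1982Higgs1, (1.7) p.605] -/
theorem rot_zero_field (lam : Site P k → ℝ) : rot C lam (0 : ScalarField P k N) = 0 := by
  rw [← rotL_apply, map_zero]

/-- `|U(λ(x))f(x)| = |f(x)|`: the rotation preserves every site norm (hence every sup norm).
[cite: Balaban1982Higgs1, (1.7) p.605] -/
theorem norm_rot_apply (lam : Site P k → ℝ) (f : ScalarField P k N) (x : Site P k) : ‖rot C lam f x‖ = ‖f x‖ :=
  HiggsGaugeInvariance.norm_U C _ _ _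

/-- the forward bond term under the gauge: `U((A − ∂λ)_b) U(λ(b₊)) = U(λ(b₋)) U(A_b)`.
[cite: Balaban1982Higgs2, Lemma 2.4 proof (2.69)–(2.70) p.572] -/
theorem U_gauge_fwd (η a lp lx : ℝ) (v : E N) :
    C.U η (a - η⁻¹ * (lp - lx)) (C.U η (η⁻¹ * lp) v) = C.U η (η⁻¹ * lx) (C.U η a v) := by
  rw [← U_add_apply, ← U_add_apply]; congr 2; ring

/-- the backward bond term under the gauge: `U((A − ∂λ)_b)^* U(λ(b₋)) = U(λ(b₊)) U(A_b)^*`.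
[cite: Balaban1982Higgs2, Lemma 2.4 proof (2.69)–(2.70) p.572] -/
theorem U_gauge_bwd (η a lx lm : ℝ) (v : E N) :
    star (C.U η (a - η⁻¹ * (lx - lm))) (C.U η (η⁻¹ * lm) v) = C.U η (η⁻¹ * lx) (star (C.U η a) v) := by
  rw [ChargeData.star_U, ChargeData.star_U, ← U_add_apply, ← U_add_apply]; congr 2; ring

end RotAlgebra

/-! ## §5 (2.69)–(2.72): the operators of (2.20)/(2.56) are GAUGE COVARIANT on the carrier of record -/

section Operators

variable (C : ChargeData N)

/-- **The Neumann covariant Laplacian of a region is gauge covariant**: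
`(−Δ^{η,N}_{A−∂λ,Ω})(U(λ)f) = U(λ)((−Δ^{η,N}_{A,Ω})f)` for EVERY region `Ω ⊂ T^{(k)}`, field `A` and gauge function `λ`
— print's «Let us consider how the operator −Δ^{η,N}_{A₀,□} + … transforms itself under this gauge transformation. We
consider the terms determining the corresponding quadratic form: |φ₀(b₋) − U(A₀(b))φ₀(b₊)|² = …» (2.69)–(2.70), here for an
arbitrary gauge instead of the constant field's. [cite: Balaban1982Higgs2, Lemma 2.4 proof (2.69)–(2.70) p.572] -/
theorem covLaplacianN_gauge {k : ℕ} (Ω : Finset (Site P k)) (lam : Site P k → ℝ) (A : VecField P k)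
    (f : ScalarField P k N) :
    covLaplacianN C Ω (gaugeVec lam A) (rot C lam f) = rot C lam (covLaplacianN C Ω A f) := by
  funext x
  have happ : ∀ (B : VecField P k) (g : ScalarField P k N), covLaplacianN C Ω B g x
      = ((P.mesh k)⁻¹ ^ 2) • ∑ μ : Fin P.d, (fwdTerm C Ω B x μ g + bwdTerm C Ω B x μ g) := by
    intro B g
    simp only [covLaplacianN, LinearMap.pi_apply, LinearMap.smul_apply, LinearMap.coe_sum, Finset.sum_apply,
      LinearMap.add_apply]
  have hfwd : ∀ (B : VecField P k) (g : ScalarField P k N) (μ : Fin P.d), fwdTerm C Ω B x μ g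
      = if x ∈ Ω ∧ x.shift μ ∈ Ω then g x - C.U (P.mesh k) (B ⟨x, μ⟩) (g (x.shift μ)) else 0 := by
    intro B g μ
    unfold fwdTerm
    split_ifs <;> simp
  have hbwd : ∀ (B : VecField P k) (g : ScalarField P k N) (μ : Fin P.d), bwdTerm C Ω B x μ g
      = if x ∈ Ω ∧ x.unshift μ ∈ Ω then g x - star (C.U (P.mesh k) (B ⟨x.unshift μ, μ⟩)) (g (x.unshift μ))
        else 0 := by
    intro B g μ
    unfold bwdTerm
    split_ifs <;> simp
  have hrot : rot C lam (covLaplacianN C Ω A f) x = C.U (P.mesh k) ((P.mesh k)⁻¹ * lam x) (covLaplacianN C Ω A f x) := rfl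
  rw [hrot, happ, happ, map_smul, map_sum]
  congr 1
  refine Finset.sum_congr rfl fun μ _ => ?_
  rw [map_add, hfwd, hfwd, hbwd, hbwd]
  congr 1
  · split_ifs
    · simp only [rot, gaugeVec, grad, Pi.sub_apply, PBond.tgt, map_sub, U_gauge_fwd]
    · simp
  · split_ifs
    · simp only [rot, gaugeVec, grad, Pi.sub_apply, PBond.tgt, map_sub, shift_unshift, U_gauge_bwd]
    · simp

/-- **The averaging operator (2.11) is gauge covariant — (2.72)**: `Q_k(A − ∂λ)(U(λ)f) = U(λ_k)(Q_k(A)f)`, `λ_k(y) = λ(ȳ)`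
the gauge function read at the site `ȳ ∈ T_ε` labelling the block point `y` (the start of `Γ^{(k)}_{y,x}`) — print's
«(Q_k(A₀)φ₀)(y′) = U(A₀(Γ_{y′,y}))(Q_kφ₀′)(y′)» for an arbitrary gauge. [cite: Balaban1982Higgs2, Lemma 2.4 proof (2.71)–(2.72) p.573] -/
theorem avgQk_gauge (lam : Site P 0 → ℝ) (A : VecField P 0) (k : ℕ) (f : ScalarField P 0 N) :
    avgQk C (gaugeVec lam A) k (rot C lam f) = rot C (fun y => lam (toFinest y)) (avgQk C A k f) := by
  funext y
  have hrot : ∀ g : ScalarField P k N, rot C (fun y => lam (toFinest y)) g y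
      = C.U (P.mesh k) ((P.mesh k)⁻¹ * lam (toFinest y)) (g y) := fun g => rfl
  rw [hrot, avgQk_apply, avgQk_apply]
  have hx : ∀ x ∈ blockK k y, C.U (P.mesh 0) (multiContourSum (gaugeVec lam A) k x) (rot C lam f x)
      = C.U (P.mesh 0) ((P.mesh 0)⁻¹ * lam (toFinest y)) (C.U (P.mesh 0) (multiContourSum A k x) (f x)) := by
    intro x hx
    have hfx : rot C lam f x = C.U (P.mesh 0) ((P.mesh 0)⁻¹ * lam x) (f x) := rfl
    rw [hfx, U_multiContourSum_gaugeVec, (mem_blockK k y x).1 hx, U_angle_add, neg_add_cancel, mul_zero,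
      ChargeData.U_zero, one_apply_eq_self]
  rw [Finset.sum_congr rfl hx, ← map_sum, ← map_smul]
  exact congrFun (congrArg DFunLike.coe (U_angle_eq C (P.mesh_pos 0).ne' (P.mesh_pos k).ne' _)) _

/-- (2.72) for the packaged linear map `avgQkLin`. [cite: Balaban1982Higgs2, Lemma 2.4 proof (2.72) p.573] -/
theorem avgQkLin_gauge (lam : Site P 0 → ℝ) (A : VecField P 0) (k : ℕ) (f : ScalarField P 0 N) :
    avgQkLin C (gaugeVec lam A) k (rot C lam f) = rot C (fun y => lam (toFinest y)) (avgQkLin C A k f) := by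
  have h1 : avgQkLin C (gaugeVec lam A) k (rot C lam f) = avgQk C (gaugeVec lam A) k (rot C lam f) :=
    funext fun y => avgQkLin_apply C _ k _ y
  have h2 : avgQkLin C A k f = avgQk C A k f := funext fun y => avgQkLin_apply C A k f y
  rw [h1, h2, avgQk_gauge]

/-- **The adjoint averaging `Q_k^*` (2.20) is gauge covariant**: `Q_k^*(A − ∂λ)(U(λ_k)ψ) = U(λ)(Q_k^*(A)ψ)`.
[cite: Balaban1982Higgs2, Lemma 2.4 proof (2.72)–(2.74) p.573] -/
theorem avgQkAdj_gauge (lam : Site P 0 → ℝ) (A : VecField P 0) (k : ℕ) (ψ : ScalarField P k N) :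
    avgQkAdj C (gaugeVec lam A) k (rot C (fun y => lam (toFinest y)) ψ) = rot C lam (avgQkAdj C A k ψ) := by
  funext x
  have hL : avgQkAdj C (gaugeVec lam A) k (rot C (fun y => lam (toFinest y)) ψ) x
      = star (C.U (P.mesh 0) (multiContourSum (gaugeVec lam A) k x))
          (C.U (P.mesh k) ((P.mesh k)⁻¹ * lam (toFinest (blockIter k x))) (ψ (blockIter k x))) := rfl
  have hR : rot C lam (avgQkAdj C A k ψ) x
      = C.U (P.mesh 0) ((P.mesh 0)⁻¹ * lam x) (star (C.U (P.mesh 0) (multiContourSum A k x)) (ψ (blockIter k x))) := rfl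
  rw [hL, hR, star_U_multiContourSum_gaugeVec,
    ← U_angle_eq C (P.mesh_pos 0).ne' (P.mesh_pos k).ne' (lam (toFinest (blockIter k x))), U_angle_add,
    neg_add_cancel, mul_zero, ChargeData.U_zero, one_apply_eq_self]

/-- **`P_k(A) = Q_k^*(A)Q_k(A)` (2.20) is gauge covariant**: `P_k(A − ∂λ)(U(λ)f) = U(λ)(P_k(A)f)` — print's
«|(Q_k(A₀)φ₀)(y′)|² = |(Q_kφ₀′)(y′)|²» at operator level. [cite: Balaban1982Higgs2, Lemma 2.4 proof (2.72) p.573] -/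
theorem projPk_gauge (lam : Site P 0 → ℝ) (A : VecField P 0) (k : ℕ) (f : ScalarField P 0 N) :
    projPk C (gaugeVec lam A) k (rot C lam f) = rot C lam (projPk C A k f) := by
  unfold projPk
  rw [LinearMap.comp_apply, LinearMap.comp_apply, avgQkLin_gauge, avgQkAdj_gauge]

/-- **The operator of (2.20)/(2.22) is gauge covariant**: `H_k(Ω, A − ∂λ)(U(λ)f) = U(λ)(H_k(Ω, A)f)`,
`H_k(Ω,A) = −Δ^{ε,N}_{A,Ω} + m² + a_k(Lᵏε)⁻²P_k(A)` — print's «Hence the operator −Δ^{η,N}_{A₀,□} + m²(Lᵏε)² + a_kP_k(A₀)□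
is transformed into the operator −Δ^{η,N}_{0,□} + m²(Lᵏε)² + a_kP_k□», for an arbitrary gauge `λ` and field `A` in place of
`A₀(Γ_{·,y})` and `A₀`. [cite: Balaban1982Higgs2, Lemma 2.4 proof p.573 «Hence the operator … is transformed into the operator …»] -/
theorem covOpK_gauge (Ω : Finset (Site P 0)) (lam : Site P 0 → ℝ) (A : VecField P 0) (msq a : ℝ) (k : ℕ)
    (f : ScalarField P 0 N) :
    covOpK C Ω (gaugeVec lam A) msq a k (rot C lam f) = rot C lam (covOpK C Ω A msq a k f) := by
  unfold covOpK
  simp only [LinearMap.add_apply, LinearMap.smul_apply, LinearMap.id_apply]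
  rw [covLaplacianN_gauge, projPk_gauge, rot_add_field, rot_add_field, rot_smul_field, rot_smul_field]

/-- operator form: `H_k(Ω, A − ∂λ) = U(λ) H_k(Ω, A) U(λ)⁻¹`. [cite: Balaban1982Higgs2, Lemma 2.4 proof p.573 «Hence the operator … is transformed into the operator …»] -/
theorem covOpK_gauge_conj (Ω : Finset (Site P 0)) (lam : Site P 0 → ℝ) (A : VecField P 0) (msq a : ℝ) (k : ℕ) :
    covOpK C Ω (gaugeVec lam A) msq a k = rotL C lam * covOpK C Ω A msq a k * rotL C (-lam) := by
  refine LinearMap.ext fun f => ?_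
  rw [Module.End.mul_apply, Module.End.mul_apply, rotL_apply, rotL_apply, ← covOpK_gauge, rot_rot_neg]

end Operators

/-! ## §6 (2.73)–(2.74): the propagator `G^ε_k(Ω, A)`, its kernel and the background field `φ^{(k)}` (2.56) -/

section Propagator

/-- `Ring.inverse` commutes with conjugation by a unit, WITHOUT any invertibility hypothesis on the conjugated element
(if `H` is not a unit neither is `uHu⁻¹`, and both sides are `0`); private plumbing. [folklore] -/
private theorem ring_inverse_conj {M : Type*} [MonoidWithZero M] (u : Mˣ) (H : M) :
    Ring.inverse ((u : M) * H * (u⁻¹ : Mˣ)) = (u : M) * Ring.inverse H * (u⁻¹ : Mˣ) := by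
  by_cases hH : IsUnit H
  · obtain ⟨w, rfl⟩ := hH
    rw [show ((u : M) * (w : M) * ((u⁻¹ : Mˣ) : M)) = ((u * w * u⁻¹ : Mˣ) : M) by simp, Ring.inverse_unit,
      Ring.inverse_unit, mul_inv_rev, mul_inv_rev, inv_inv, Units.val_mul, Units.val_mul, mul_assoc]
  · have h' : ¬ IsUnit ((u : M) * H * ((u⁻¹ : Mˣ) : M)) := by
      rwa [Units.isUnit_mul_units, Units.isUnit_units_mul]
    rw [Ring.inverse_non_unit _ hH, Ring.inverse_non_unit _ h', mul_zero, zero_mul]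

variable (C : ChargeData N)

/-- **THE PROPAGATOR (2.20) IS GAUGE COVARIANT — (2.73) at operator level**:
`G^ε_k(Ω, A − ∂λ) = U(λ) G^ε_k(Ω, A) U(λ)⁻¹` for EVERY region `Ω`, field `A`, gauge function `λ`, `m²`, `a`, `k` —
unconditionally (no invertibility hypothesis: `propagatorK = Ring.inverse (covOpK …)` and `Ring.inverse` commutes
with conjugation).  Print, for the constant field gauged to zero on `□`: «G_k(□, A₀; x, x′) =
U(A₀(Γ_{x,y}))G_k(□, 0; x, x′)U(A₀(Γ_{y,x′})) (2.73)». [cite: Balaban1982Higgs2, Lemma 2.4 proof (2.73) p.573] -/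
theorem propagatorK_gauge_conj (Ω : Finset (Site P 0)) (lam : Site P 0 → ℝ) (A : VecField P 0) (msq a : ℝ) (k : ℕ) :
    propagatorK C Ω (gaugeVec lam A) msq a k = rotL C lam * propagatorK C Ω A msq a k * rotL C (-lam) := by
  unfold propagatorK
  rw [covOpK_gauge_conj, ← rotUnit_val, ← rotUnit_inv_val, ring_inverse_conj]

/-- (2.73), applied form: `G^ε_k(Ω, A − ∂λ)(U(λ)f) = U(λ)(G^ε_k(Ω, A)f)`. [cite: Balaban1982Higgs2, Lemma 2.4 proof (2.73) p.573] -/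
theorem propagatorK_gauge (Ω : Finset (Site P 0)) (lam : Site P 0 → ℝ) (A : VecField P 0) (msq a : ℝ) (k : ℕ)
    (f : ScalarField P 0 N) :
    propagatorK C Ω (gaugeVec lam A) msq a k (rot C lam f) = rot C lam (propagatorK C Ω A msq a k f) := by
  rw [propagatorK_gauge_conj, Module.End.mul_apply, Module.End.mul_apply, rotL_apply, rotL_apply, rot_neg_rot]

/-- the matrix element `G(x, x′)v = (G(vδ_{x′}))(x)` (unfolding of the typer's `HiggsCovariance.kernel`; the level-`k`
form is the typer's `B2Eq230CondShift.kernel_apply_single`, not imported). [cite: Balaban1982Higgs1, (2.24) p.610] -/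
private theorem kernel_apply (G : Module.End ℝ (ScalarField P 0 N)) (x x' : Site P 0) (v : E N) :
    kernel G x x' v = G (Pi.single x' v) x := by
  simp [kernel]

/-- **(2.73) FOR THE KERNELS**: `G^ε_k(Ω, A − ∂λ; x, x′) = U(λ(x)) G^ε_k(Ω, A; x, x′) U(λ(x′))⁻¹` — print's
«G_k(□, A₀; x, x′) = U(A₀(Γ_{x,y}))G_k(□, 0; x, x′)U(A₀(Γ_{y,x′}))» with `(A₀, 0)` generalised to `(A, A − ∂λ)` (read from right to
left: `A = (A − ∂λ) + ∂λ`; for print's pair take `λ` with `∂λ = A₀` on `□`, §7). [cite: Balaban1982Higgs2, Lemma 2.4 proof (2.73) p.573] -/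
theorem kernel_propagatorK_gauge (Ω : Finset (Site P 0)) (lam : Site P 0 → ℝ) (A : VecField P 0) (msq a : ℝ) (k : ℕ)
    (x x' : Site P 0) (v : E N) :
    kernel (propagatorK C Ω (gaugeVec lam A) msq a k) x x' v
      = C.U (P.mesh 0) ((P.mesh 0)⁻¹ * lam x)
          (kernel (propagatorK C Ω A msq a k) x x' (C.U (P.mesh 0) ((P.mesh 0)⁻¹ * (-lam x')) v)) := by
  rw [kernel_apply, kernel_apply]
  have h : (Pi.single x' v : ScalarField P 0 N) = rot C lam (rot C (-lam) (Pi.single x' v)) := (rot_rot_neg C lam _).symm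
  rw [h, propagatorK_gauge, rot_single]
  rfl

/-- the cut `Λφ` of (2.56) commutes with the gauge rotation. [cite: Balaban1982Higgs2, (2.56) p.570] -/
theorem cutTo_rot {k : ℕ} (Λ : Finset (Site P k)) (lam : Site P k → ℝ) (φ : ScalarField P k N) :
    B2Eq255Concrete.cutTo Λ (rot C lam φ) = rot C lam (B2Eq255Concrete.cutTo Λ φ) := by
  funext x
  by_cases hx : x ∈ Λ
  · rw [B2Eq255Concrete.cutTo_of_mem Λ _ hx]
    show _ = C.U _ _ (B2Eq255Concrete.cutTo Λ φ x)
    rw [B2Eq255Concrete.cutTo_of_mem Λ _ hx]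
    rfl
  · rw [B2Eq255Concrete.cutTo_of_not_mem Λ _ hx]
    show (0 : E N) = C.U _ _ (B2Eq255Concrete.cutTo Λ φ x)
    rw [B2Eq255Concrete.cutTo_of_not_mem Λ _ hx, map_zero]

/-- **(2.74): THE BACKGROUND FIELD (2.56) IS GAUGE COVARIANT** — `φ^{(k)}` of the typer's `bgScalar256`, i.e.
`a_k(Lᵏε)⁻²G^ε_k(Bᵏ(Λ₂), A)Q_k^*(A)(Λ₆φ)`, satisfies
`φ^{(k)}[A − ∂λ, U(λ_k)φ] = U(λ)·φ^{(k)}[A, φ]` for every pair of regions `Λ₂, Λ₆`, field `A`, gauge `λ` — print's «Together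
with the gauge transformation of the propagators we make the corresponding transformation of the field φ, i.e.
φ(y′) = U(A₀(Γ_{y′,y}))φ′(y′). Then the last expression in (2.68) transforms itself as follows
(a_kG_k(□, A₀)Q_k^*(A₀)□₁φ)(x) = U(A₀(Γ_{x,y}))(a_kG_k(□, 0)Q_k^*□₁φ′)(x). (2.74)», for an arbitrary gauge (print's case:
`Λ₂ = □₂`, `Λ₆ = □₁`, `λ` the constant field's gauge function of §7). [cite: Balaban1982Higgs2, Lemma 2.4 proof (2.74) p.573] -/
theorem bgScalar256_gauge (msq a : ℝ) (k : ℕ) (Λ₂ Λ₆ : Finset (Site P k)) (lam : Site P 0 → ℝ) (A : VecField P 0)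
    (φ : ScalarField P k N) :
    B2Eq255Concrete.bgScalar256 C msq a k Λ₂ Λ₆ (gaugeVec lam A) (rot C (fun y => lam (toFinest y)) φ)
      = rot C lam (B2Eq255Concrete.bgScalar256 C msq a k Λ₂ Λ₆ A φ) := by
  rw [B2Eq255Concrete.bgScalar256_eq, B2Eq255Concrete.bgScalar256_eq, cutTo_rot, avgQkAdj_gauge, propagatorK_gauge,
    rot_smul_field]

/-- **the structure of (2.77)**: the covariant derivative of the gauged background field is the rotated covariant
derivative, `(D^ε_{A−∂λ}φ^{(k)}[A − ∂λ, U(λ_k)φ])(b) = U(λ(b₋))·(D^ε_Aφ^{(k)}[A, φ])(b)` (with p28's `covDeriv_gauge`) — print's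
«It was mentioned several times that the corresponding equalities hold for the covariant derivatives of φ^{(k)}».
[cite: Balaban1982Higgs2, Lemma 2.4 proof (2.77) p.573] -/
theorem covDeriv_bgScalar256_gauge (msq a : ℝ) (k : ℕ) (Λ₂ Λ₆ : Finset (Site P k)) (lam : Site P 0 → ℝ)
    (A : VecField P 0) (φ : ScalarField P k N) (b : PBond P 0) :
    covDeriv C (gaugeVec lam A)
        (B2Eq255Concrete.bgScalar256 C msq a k Λ₂ Λ₆ (gaugeVec lam A) (rot C (fun y => lam (toFinest y)) φ)) b
      = C.U (P.mesh 0) ((P.mesh 0)⁻¹ * lam b.src) (covDeriv C A (B2Eq255Concrete.bgScalar256 C msq a k Λ₂ Λ₆ A φ) b) := by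
  rw [bgScalar256_gauge, covDeriv_gauge]

/-- sup norms are gauge invariant: `‖φ^{(k)}[A − ∂λ, U(λ_k)φ](x)‖ = ‖φ^{(k)}[A, φ](x)‖` and the same for the covariant
derivatives — the form in which (2.74)/(2.77) feed the estimates (2.65)/(2.66). [cite: Balaban1982Higgs2, Lemma 2.4 proof (2.74) p.573] -/
theorem norm_bgScalar256_gauge (msq a : ℝ) (k : ℕ) (Λ₂ Λ₆ : Finset (Site P k)) (lam : Site P 0 → ℝ) (A : VecField P 0)
    (φ : ScalarField P k N) (x : Site P 0) (b : PBond P 0) :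
    ‖B2Eq255Concrete.bgScalar256 C msq a k Λ₂ Λ₆ (gaugeVec lam A) (rot C (fun y => lam (toFinest y)) φ) x‖
        = ‖B2Eq255Concrete.bgScalar256 C msq a k Λ₂ Λ₆ A φ x‖ ∧
      ‖covDeriv C (gaugeVec lam A)
          (B2Eq255Concrete.bgScalar256 C msq a k Λ₂ Λ₆ (gaugeVec lam A) (rot C (fun y => lam (toFinest y)) φ)) b‖
        = ‖covDeriv C A (B2Eq255Concrete.bgScalar256 C msq a k Λ₂ Λ₆ A φ) b‖ := by
  rw [bgScalar256_gauge, norm_rot_apply, covDeriv_gauge, HiggsGaugeInvariance.norm_U]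
  exact ⟨rfl, rfl⟩

end Propagator

/-! ## §7 Print's case: a CONSTANT configuration `A₀` and its gauge function `εA₀(Γ_{y,·})` from a corner `y` -/

section ConstField

/-- «a constant configuration A₀» (p. 572): the vector field with the same value `c_μ` on every bond of direction `μ`.
[cite: Balaban1982Higgs2, Lemma 2.4 proof p.572 «Let us denote by A₀ a constant configuration equal to A^{(k)}(y) at each point»] -/
def constVec (c : Fin P.d → ℝ) : VecField P 0 := fun b => c b.dir

/-- unfolding of `constVec`. [cite: Balaban1982Higgs2, Lemma 2.4 proof p.572 «a constant configuration»] -/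
@[simp] theorem constVec_apply (c : Fin P.d → ℝ) (b : PBond P 0) : constVec c b = c b.dir := rfl

/-- the gauge function of the constant field from the corner `o`: `λ_o(z) = ε·Σ_μ c_μ·n_μ(z)`, `n_μ(z) ∈ [0, |T_ε|_μ)` the
number of forward steps from `o` to `z` in direction `μ` — print's «U(A₀(Γ_{x,y}))φ₀′(x), x ∈ □, where the contour Γ_{x,y} =
−Γ_{y,x} is defined as in (I.2.1), but now for the points x from □ instead of the block B(y)» with `y ↦ o` (below:
`λ_o(z) = ε·A₀(Γ_{o,z})` for the carrier's staircase `Γ_{o,z}`). [cite: Balaban1982Higgs2, Lemma 2.4 proof p.572 «φ₀(x) = U(A₀(Γ_{x,y}))φ₀′(x), x ∈ □»] -/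
def cornerGauge (o : Site P 0) (c : Fin P.d → ℝ) : Site P 0 → ℝ :=
  fun z => P.mesh 0 * ∑ μ : Fin P.d, ((z μ - o μ).val : ℝ) * c μ

/-- along a straight segment a constant field sums to `n·c_μ`. [cite: Balaban1982Higgs1, (2.3) p.608] -/
theorem segSum_constVec (c : Fin P.d → ℝ) (u : Site P 0) (μ : Fin P.d) (n : ℕ) :
    segSum (constVec c) u μ n = n * c μ := by
  simp [segSum, Finset.sum_const, nsmul_eq_mul]

/-- **`A₀(Γ_{o,z}) = Σ_μ n_μ(z)·c_μ`** for the carrier's staircase contour (I.2.1) from `o` to `z` (its `μ`-th segment has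
`n_μ(z) = (z_μ − o_μ) mod |T_ε|_μ` forward bonds). [cite: Balaban1982Higgs1, (2.1)–(2.3) p.608] -/
theorem contourSum_constVec (c : Fin P.d → ℝ) (o z : Site P 0) :
    contourSum (constVec c) o z = ∑ μ : Fin P.d, ((z μ - o μ).val : ℝ) * c μ := by
  simp [contourSum, segSum_constVec]

/-- `λ_o(z) = ε·A₀(Γ_{o,z})`. [cite: Balaban1982Higgs2, Lemma 2.4 proof p.572 «φ₀(x) = U(A₀(Γ_{x,y}))φ₀′(x), x ∈ □»] -/
theorem cornerGauge_eq_contourSum (o : Site P 0) (c : Fin P.d → ℝ) (z : Site P 0) :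
    cornerGauge o c z = P.mesh 0 * contourSum (constVec c) o z := by
  rw [contourSum_constVec]; rfl

variable (C : ChargeData N)

/-- the rotation by `λ_o` IS print's transporter: `U_ε(ε⁻¹λ_o(z)) = U(A₀(Γ_{o,z}))`, and `U_ε(ε⁻¹(−λ_o(z))) = U(A₀(Γ_{z,o}))`
(`Γ_{z,o} = −Γ_{o,z}`). [cite: Balaban1982Higgs2, Lemma 2.4 proof p.572 «φ₀(x) = U(A₀(Γ_{x,y}))φ₀′(x), x ∈ □»] -/
theorem U_cornerGauge (o : Site P 0) (c : Fin P.d → ℝ) (z : Site P 0) :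
    C.U (P.mesh 0) ((P.mesh 0)⁻¹ * cornerGauge o c z) = C.U (P.mesh 0) (contourSum (constVec c) o z) ∧
    C.U (P.mesh 0) ((P.mesh 0)⁻¹ * (-cornerGauge o c z)) = C.U (P.mesh 0) (-contourSum (constVec c) o z) := by
  have hε : P.mesh 0 ≠ 0 := (P.mesh_pos 0).ne'
  rw [cornerGauge_eq_contourSum, ← mul_neg, ← mul_assoc, ← mul_assoc, inv_mul_cancel₀ hε, one_mul, one_mul]
  exact ⟨rfl, rfl⟩

/-- every direction of the torus has at least two sites (`|T_ε|_μ = 2·L^{K}ML′_μ`). [cite: Balaban1982Higgs1, (1.2) p.604] -/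
theorem one_lt_sitesPerDir (k : ℕ) (μ : Fin P.d) : 1 < P.sitesPerDir k μ := by
  have h := P.sitesPerDir_pos k μ
  rw [Params.sitesPerDir_eq] at h ⊢
  omega

/-- **`∂λ_o = A₀` OFF THE SEAM**: on every bond `⟨z, z + εe_μ⟩` whose step does not wrap around the period box based at
`o` (`n_μ(z) + 1 < |T_ε|_μ`) the gradient of the corner gauge is the constant field.  On a box `□ ∋ o` of side `< |T_ε|_μ`
with lower corner `o` this is every bond of `□` — print's «A₀(Γ_{y,b₋}∪b∪Γ_{b₊,y}) = 0» (2.70) ⇒ «(D^η_{A₀}φ₀)(b) =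
U(A₀(Γ_{b₋,y}))(∂^ηφ₀′)(b)». [cite: Balaban1982Higgs2, Lemma 2.4 proof (2.70) p.572] -/
theorem grad_cornerGauge_of_noWrap (o : Site P 0) (c : Fin P.d → ℝ) {z : Site P 0} {μ : Fin P.d}
    (h : (z μ - o μ).val + 1 < P.sitesPerDir 0 μ) : grad (cornerGauge o c) ⟨z, μ⟩ = c μ := by
  have hε : P.mesh 0 ≠ 0 := (P.mesh_pos 0).ne'
  haveI : Fact (1 < P.sitesPerDir 0 μ) := ⟨one_lt_sitesPerDir 0 μ⟩
  have hval : ((z.shift μ) μ - o μ).val = (z μ - o μ).val + 1 := by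
    have e1 : (z.shift μ) μ - o μ = (z μ - o μ) + 1 := by simp [Site.shift]; ring
    rw [e1, ZMod.val_add_of_lt, ZMod.val_one]
    rwa [ZMod.val_one]
  have hother : ∀ ν, ν ≠ μ → ((z.shift μ) ν - o ν).val = (z ν - o ν).val := by
    intro ν hν; simp [Site.shift, hν]
  simp only [grad, PBond.tgt, cornerGauge]
  rw [← mul_sub, ← Finset.sum_sub_distrib, ← mul_assoc, inv_mul_cancel₀ hε, one_mul,
    Finset.sum_eq_single μ (fun ν _ hν => by rw [hother ν hν, sub_self]) (fun h => (h (Finset.mem_univ μ)).elim),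
    hval]
  push_cast
  ring

/-- the SEAM FIELD `A₀ − ∂λ_o`: zero off the seam of the period box based at `o` (previous theorem), it carries the
holonomy of the constant field around the torus. [cite: Balaban1982Higgs2, Lemma 2.4 proof (2.70) p.572] -/
def seamField (o : Site P 0) (c : Fin P.d → ℝ) : VecField P 0 := constVec c - grad (cornerGauge o c)

/-- `(A₀ − ∂λ_o)_b = 0` on every non-wrapping bond. [cite: Balaban1982Higgs2, Lemma 2.4 proof (2.70) p.572] -/
theorem seamField_eq_zero_of_noWrap (o : Site P 0) (c : Fin P.d → ℝ) {z : Site P 0} {μ : Fin P.d}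
    (h : (z μ - o μ).val + 1 < P.sitesPerDir 0 μ) : seamField o c ⟨z, μ⟩ = 0 := by
  simp [seamField, grad_cornerGauge_of_noWrap o c h]

/-- gauging `A = A₀ + A′` by `λ_o` leaves `A′` plus the seam field: `(A₀ + A′) − ∂λ_o = A′ + (A₀ − ∂λ_o)`.
[cite: Balaban1982Higgs2, Lemma 2.4 proof p.572 «Now the constant field A₀ can be "gauged out"»] -/
theorem gaugeVec_cornerGauge (o : Site P 0) (c : Fin P.d → ℝ) (A' : VecField P 0) :
    gaugeVec (cornerGauge o c) (constVec c + A') = A' + seamField o c := by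
  funext b; simp only [gaugeVec, seamField, Pi.add_apply, Pi.sub_apply]; ring

/-- undoing a gauge: `(A − ∂λ) − ∂(−λ) = A`. [cite: Balaban1982Higgs1, (1.8) p.605] -/
theorem gaugeVec_neg_gaugeVec (lam : Site P 0 → ℝ) (A : VecField P 0) : gaugeVec (-lam) (gaugeVec lam A) = A := by
  funext b; simp only [gaugeVec, grad, Pi.sub_apply, Pi.neg_apply]; ring

/-- **(2.73) IN PRINT'S LETTERS**: for `A = A₀ + A′` with `A₀` constant and any corner `o`,
`G^ε_k(Ω, A₀ + A′; x, x′) = U(A₀(Γ_{x,o})) · G^ε_k(Ω, A′ + (A₀ − ∂λ_o); x, x′) · U(A₀(Γ_{o,x′}))` — EXACT on the whole torus;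
print's display is `A′ = 0`, `o = y`, read on the box `□` around `y`, where every bond is off the seam so that `A₀ − ∂λ_o`
is invisible to `G_k(□, ·)` (the locality of the Neumann box operator in the field — not part of this file).
[cite: Balaban1982Higgs2, Lemma 2.4 proof (2.73) p.573] -/
theorem kernel_propagatorK_constVec (Ω : Finset (Site P 0)) (o : Site P 0) (c : Fin P.d → ℝ) (A' : VecField P 0)
    (msq a : ℝ) (k : ℕ) (x x' : Site P 0) (v : E N) :
    kernel (propagatorK C Ω (constVec c + A') msq a k) x x' v
      = C.U (P.mesh 0) (-contourSum (constVec c) o x)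
          (kernel (propagatorK C Ω (A' + seamField o c) msq a k) x x' (C.U (P.mesh 0) (contourSum (constVec c) o x') v)) := by
  have h := kernel_propagatorK_gauge C Ω (-cornerGauge o c) (gaugeVec (cornerGauge o c) (constVec c + A')) msq a k x x' v
  rw [gaugeVec_neg_gaugeVec, gaugeVec_cornerGauge] at h
  rw [h, Pi.neg_apply, Pi.neg_apply, neg_neg, (U_cornerGauge C o c x).2, (U_cornerGauge C o c x').1]

/-- **(2.74) IN PRINT'S LETTERS**: `φ^{(k)}[A₀ + A′, φ](x) = U(A₀(Γ_{x,o}))·φ^{(k)}[A′ + (A₀ − ∂λ_o), φ′](x)` with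
`φ′(y′) = U(A₀(Γ_{o,ȳ′}))φ(y′)` (print: «φ(y′) = U(A₀(Γ_{y′,y}))φ′(y′) … (a_kG_k(□, A₀)Q_k^*(A₀)□₁φ)(x) =
U(A₀(Γ_{x,y}))(a_kG_k(□, 0)Q_k^*□₁φ′)(x) (2.74)», `A′ = 0`, `o = y`). [cite: Balaban1982Higgs2, Lemma 2.4 proof (2.74) p.573] -/
theorem bgScalar256_constVec (msq a : ℝ) (k : ℕ) (Λ₂ Λ₆ : Finset (Site P k)) (o : Site P 0) (c : Fin P.d → ℝ)
    (A' : VecField P 0) (φ : ScalarField P k N) :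
    B2Eq255Concrete.bgScalar256 C msq a k Λ₂ Λ₆ (constVec c + A') φ
      = rot C (-cornerGauge o c)
          (B2Eq255Concrete.bgScalar256 C msq a k Λ₂ Λ₆ (A' + seamField o c)
            (rot C (fun y => cornerGauge o c (toFinest y)) φ)) := by
  have h := bgScalar256_gauge C msq a k Λ₂ Λ₆ (-cornerGauge o c) (gaugeVec (cornerGauge o c) (constVec c + A'))
    (rot C (fun y => cornerGauge o c (toFinest y)) φ)
  rw [gaugeVec_neg_gaugeVec, gaugeVec_cornerGauge] at h
  rw [← h]
  congr 1
  exact (rot_neg_rot C (fun y => cornerGauge o c (toFinest y)) φ).symm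

end ConstField

end Literature.MathematicalPhysics.QuantumFieldTheory.Balaban1983to89.B2Eq273GaugeCovariance

end
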